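import Summits.FinalStateConjecture.FinalStateConjecture.Theorems.PhotonSphereChannelsBlindnessWaveEnergy

/-!
# Route PhotonSphereChannels · BlindnessInsidePhotonSphere — the energy inequality and the
# monotonicity of channel energies

Support file (pure analysis, everything proved) for item stmt-FinalStateConjecture-10049,
consequences of the weighted energy identity of `PhotonSphereChannelsBlindnessWaveEnergy` for
`uncurry φ ∈ C²` vanishing outside a domain of influence, `V ∈ C¹`, `V ≥ 0`:

* `energy_le_of_forcing` — **energy inequality** (Grönwall form): if `φ` has zero Cauchy data at
  `t = 0` and `∫ F(t, x)² dx ≤ N²` on `[0, T]`, `F = φ_tt − φ_xx + Vφ`, then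
  `E(t) = ∫ (φ_t² + φ_x² + Vφ²) ≤ (e − 1) T² N²` on `[0, T]`
  (from `E' = 2∫φ_t F ≤ E/T + T N²`; Evans, *PDE*, §7.2.2, Thm. 2);
* `antitone_weightedEnergy` — for a solution (`F = 0`) and a non-decreasing `C¹` weight `χ`,
  `s ↦ ∫ χ(x − s) e(s, x) dx` is non-increasing (outgoing null flux `(φ_t + φ_x)² + Vφ² ≥ 0`);
* two elementary comparisons of `∫_{x > a} f` with `∫ w f` for weights pinching an indicator
  (`setIntegral_Ioi_le_integral_mul`, `integral_mul_le_setIntegral_Ioi`).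

Statements are in the `deriv` / `iteratedDeriv 2` vocabulary of the route statement.
No definitions are introduced.
-/

noncomputable section

open Set Filter MeasureTheory Topology Function

namespace Summit.FinalStateConjecture.FinalStateConjecture.Theorems.Blindness

/-! ### Elementary inequalities -/

/-- `|2ab| ≤ a²/T + T b²` for `T > 0`. -/
theorem abs_two_mul_le {T : ℝ} (hT : 0 < T) (a b : ℝ) : |2 * (a * b)| ≤ T⁻¹ * a ^ 2 + T * b ^ 2 := by
  have hTi : 0 < T⁻¹ := inv_pos.2 hT
  have key : ∀ a b : ℝ, 2 * (a * b) ≤ T⁻¹ * a ^ 2 + T * b ^ 2 := by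
    intro a b
    have h1 : T⁻¹ * (a - T * b) ^ 2 ≥ 0 := mul_nonneg hTi.le (sq_nonneg _)
    have h2 : T⁻¹ * (a - T * b) ^ 2 = T⁻¹ * a ^ 2 + T * b ^ 2 - 2 * (a * b) := by
      field_simp
      ring
    linarith
  rcases le_or_gt 0 (a * b) with h | h
  · rw [abs_of_nonneg (by linarith)]; exact key a b
  · rw [abs_of_neg (by linarith)]
    have := key a (-b)
    have hsq : (-b) ^ 2 = b ^ 2 := by ring
    rw [hsq] at this
    linarith

/-- Weights pinching an indicator, I: `∫_{x > a} f ≤ ∫ w f` if `f ≥ 0`, `w ≥ 0`, `w = 1` on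
`(a, ∞)`. -/
theorem setIntegral_Ioi_le_integral_mul {f w : ℝ → ℝ} {a : ℝ} (hf : Integrable f)
    (hfw : Integrable fun x => w x * f x) (hf0 : ∀ x, 0 ≤ f x) (hw0 : ∀ x, 0 ≤ w x)
    (hw1 : ∀ x, a < x → w x = 1) : ∫ x in Ioi a, f x ≤ ∫ x, w x * f x := by
  rw [← integral_indicator measurableSet_Ioi]
  refine integral_mono (hf.indicator measurableSet_Ioi) hfw fun x => ?_
  by_cases hx : x ∈ Ioi a
  · rw [indicator_of_mem hx, hw1 x hx, one_mul]
  · rw [indicator_of_notMem hx]; exact mul_nonneg (hw0 x) (hf0 x)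

/-- Weights pinching an indicator, II: `∫ w f ≤ ∫_{x > b} f` if `f ≥ 0`, `w ≤ 1`, `w = 0` on
`(−∞, b]`. -/
theorem integral_mul_le_setIntegral_Ioi {f w : ℝ → ℝ} {b : ℝ} (hf : Integrable f)
    (hfw : Integrable fun x => w x * f x) (hf0 : ∀ x, 0 ≤ f x) (hw1 : ∀ x, w x ≤ 1)
    (hw0 : ∀ x, x ≤ b → w x = 0) : ∫ x, w x * f x ≤ ∫ x in Ioi b, f x := by
  rw [← integral_indicator measurableSet_Ioi]
  refine integral_mono hfw (hf.indicator measurableSet_Ioi) fun x => ?_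
  by_cases hx : x ∈ Ioi b
  · rw [indicator_of_mem hx]
    simpa using mul_le_mul_of_nonneg_right (hw1 x) (hf0 x)
  · rw [indicator_of_notMem hx, hw0 x (not_lt.1 hx), zero_mul]

section Bounds

variable {φ : ℝ → ℝ → ℝ} {V : ℝ → ℝ} {α β : ℝ}

/-- Integrability, at a fixed time, of a continuous multiple of the fields of `φ`: any continuous
function vanishing wherever `φ`, `φ_t`, `φ_x`, `φ_tt`, `φ_tx`, `φ_xx` all vanish is integrable
(it has support in `[α − |s|, β + |s|]`). -/
theorem integrable_of_fields (hφ : ContDiff ℝ 2 (uncurry φ))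
    (h0 : ∀ t x, (x < α - |t| ∨ β + |t| < x) → φ t x = 0) {s : ℝ} {g : ℝ → ℝ}
    (hg : Continuous g)
    (hg0 : ∀ x, φ s x = 0 → fderiv ℝ (uncurry φ) (s, x) (1, 0) = 0 →
      fderiv ℝ (uncurry φ) (s, x) (0, 1) = 0 →
      fderiv ℝ (uncurry fun t y => fderiv ℝ (uncurry φ) (t, y) (1, 0)) (s, x) (1, 0) = 0 →
      fderiv ℝ (uncurry fun t y => fderiv ℝ (uncurry φ) (t, y) (0, 1)) (s, x) (0, 1) = 0 →
      g x = 0) : Integrable g := by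
  refine integrable_of_exterior (a := α - |s|) (b := β + |s|) hg fun x hx => ?_
  obtain ⟨h1, h2, h3⟩ := fields_eq_zero_of_exterior hφ h0 hx (1, 0) (1, 0)
  obtain ⟨-, h4, h5⟩ := fields_eq_zero_of_exterior hφ h0 hx (0, 1) (0, 1)
  exact hg0 x h1 h2 h4 h3 h5

/-- **The energy inequality.** For `uncurry φ ∈ C²` vanishing outside the domain of influence of
`[α, β]`, `V ∈ C¹`, `V ≥ 0`, with zero Cauchy data at `t = 0` and forcing
`F = φ_tt − φ_xx + Vφ` of size `∫ F(t,·)² ≤ N²` on `[0, T]`: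
`∫ (φ_t² + φ_x² + Vφ²)(t, ·) ≤ (e − 1) T² N²` for `t ∈ [0, T]`. -/
theorem energy_le_of_forcing (hφ : ContDiff ℝ 2 (uncurry φ)) (hV : ContDiff ℝ 1 V)
    (hVnn : ∀ x, 0 ≤ V x) (h0 : ∀ t x, (x < α - |t| ∨ β + |t| < x) → φ t x = 0)
    (hd0 : ∀ x, φ 0 x = 0) (hd1 : ∀ x, deriv (fun τ => φ τ x) 0 = 0)
    {T N2 : ℝ} (hT : 0 < T) (hN2 : 0 ≤ N2)
    (hN : ∀ t ∈ Icc 0 T, ∫ x, (iteratedDeriv 2 (fun τ => φ τ x) t - iteratedDeriv 2 (φ t) x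
      + V x * φ t x) ^ 2 ≤ N2) :
    ∀ t ∈ Icc 0 T, ∫ x, (deriv (fun τ => φ τ x) t ^ 2 + deriv (φ t) x ^ 2 + V x * φ t x ^ 2)
      ≤ (Real.exp 1 - 1) * T ^ 2 * N2 := by
  -- fields
  set ft : ℝ → ℝ → ℝ := fun t y => fderiv ℝ (uncurry φ) (t, y) (1, 0) with hft
  set fx : ℝ → ℝ → ℝ := fun t y => fderiv ℝ (uncurry φ) (t, y) (0, 1) with hfx
  set ftt : ℝ → ℝ → ℝ := fun t y => fderiv ℝ (uncurry ft) (t, y) (1, 0) with hftt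
  set fxx : ℝ → ℝ → ℝ := fun t y => fderiv ℝ (uncurry fx) (t, y) (0, 1) with hfxx
  have hft1 : ContDiff ℝ 1 (uncurry ft) := contDiff_one_fderiv_apply hφ (1, 0)
  have hfx1 : ContDiff ℝ 1 (uncurry fx) := contDiff_one_fderiv_apply hφ (0, 1)
  have hφ1 : ContDiff ℝ 1 (uncurry φ) := hφ.of_le (by norm_num)
  set E : ℝ → ℝ := fun t => ∫ x, (ft t x ^ 2 + fx t x ^ 2 + V x * φ t x ^ 2) with hE
  set Res : ℝ → ℝ → ℝ := fun t x => ftt t x - fxx t x + V x * φ t x with hRes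
  set E' : ℝ → ℝ := fun t => ∫ x, 2 * (ft t x * Res t x) with hE'
  -- dictionary with the statement's vocabulary
  have he_eq : ∀ t, (fun x => deriv (fun τ => φ τ x) t ^ 2 + deriv (φ t) x ^ 2 + V x * φ t x ^ 2)
      = fun x => ft t x ^ 2 + fx t x ^ 2 + V x * φ t x ^ 2 :=
    fun t => funext fun x => energyDensity_eq hφ t x
  have hres_eq : ∀ t x, iteratedDeriv 2 (fun τ => φ τ x) t - iteratedDeriv 2 (φ t) x
      + V x * φ t x = Res t x := fun t x => residual_eq hφ t x
  -- the energy identity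
  have hderiv : ∀ t, HasDerivAt E (E' t) t := fun t => hasDerivAt_energy hφ hV h0 t
  -- continuity of slices
  have hcφ : ∀ t, Continuous (φ t) := fun t => hφ.continuous.comp (Continuous.prodMk_right t)
  have hcft : ∀ t, Continuous (ft t) := fun t => hft1.continuous.comp (Continuous.prodMk_right t)
  have hcfx : ∀ t, Continuous (fx t) := fun t => hfx1.continuous.comp (Continuous.prodMk_right t)
  have hcftt : ∀ t, Continuous (ftt t) := fun t =>
    ((hft1.continuous_fderiv one_ne_zero).clm_apply continuous_const).comp
      (Continuous.prodMk_right t)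
  have hcfxx : ∀ t, Continuous (fxx t) := fun t =>
    ((hfx1.continuous_fderiv one_ne_zero).clm_apply continuous_const).comp
      (Continuous.prodMk_right t)
  have hVc : Continuous V := hV.continuous
  have hcRes : ∀ t, Continuous (Res t) := fun t =>
    ((hcftt t).sub (hcfxx t)).add (hVc.mul (hcφ t))
  -- integrability of the densities at each time
  have hIe : ∀ t, Integrable fun x => ft t x ^ 2 + fx t x ^ 2 + V x * φ t x ^ 2 := fun t =>
    integrable_of_fields (s := t) hφ h0 ((((hcft t).pow 2).add ((hcfx t).pow 2)).add
      (hVc.mul ((hcφ t).pow 2))) (fun x h1 h2 h3 _ _ => by simp [hft, hfx, h1, h2, h3])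
  have hIft : ∀ t, Integrable fun x => ft t x ^ 2 := fun t =>
    integrable_of_fields (s := t) hφ h0 ((hcft t).pow 2) (fun x _ h2 _ _ _ => by simp [hft, h2])
  have hIres : ∀ t, Integrable fun x => Res t x ^ 2 := fun t =>
    integrable_of_fields (s := t) hφ h0 ((hcRes t).pow 2)
      (fun x h1 _ _ h4 h5 => by simp [hRes, hftt, hfxx, hft, hfx, h1, h4, h5])
  have hIprod : ∀ t, Integrable fun x => 2 * (ft t x * Res t x) := fun t =>
    integrable_of_fields (s := t) hφ h0 (continuous_const.mul ((hcft t).mul (hcRes t)))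
      (fun x _ h2 _ _ _ => by simp [hft, h2])
  -- `E ≥ 0` and `∫ φ_t² ≤ E`
  have hEnn : ∀ t, 0 ≤ E t := fun t =>
    integral_nonneg fun x => by
      simp only [Pi.zero_apply]
      have := mul_nonneg (hVnn x) (sq_nonneg (φ t x))
      positivity
  have hkin : ∀ t, (∫ x, ft t x ^ 2) ≤ E t := fun t =>
    integral_mono (hIft t) (hIe t) fun x => by
      have := mul_nonneg (hVnn x) (sq_nonneg (φ t x)); nlinarith [sq_nonneg (fx t x)]
  -- the differential inequality `|E'| ≤ E/T + T N²` on `[0, T]`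
  have hbound : ∀ t ∈ Ico 0 T, ‖E' t‖ ≤ T⁻¹ * ‖E t‖ + T * N2 := by
    intro t ht
    have ht' : t ∈ Icc 0 T := Ico_subset_Icc_self ht
    rw [Real.norm_eq_abs, Real.norm_eq_abs, abs_of_nonneg (hEnn t)]
    calc |E' t| ≤ ∫ x, |2 * (ft t x * Res t x)| := by
          simpa only [Real.norm_eq_abs] using
            norm_integral_le_integral_norm (fun x => 2 * (ft t x * Res t x))
      _ ≤ ∫ x, (T⁻¹ * ft t x ^ 2 + T * Res t x ^ 2) :=
          integral_mono (hIprod t).norm (((hIft t).const_mul _).add ((hIres t).const_mul _))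
            fun x => abs_two_mul_le hT _ _
      _ = T⁻¹ * (∫ x, ft t x ^ 2) + T * (∫ x, Res t x ^ 2) := by
          rw [integral_add ((hIft t).const_mul _) ((hIres t).const_mul _), integral_const_mul,
            integral_const_mul]
      _ ≤ T⁻¹ * E t + T * N2 := by
          have h1 := hkin t
          have h2 : (∫ x, Res t x ^ 2) ≤ N2 := by
            have := hN t ht'
            simpa only [hres_eq] using this
          have hTi : 0 ≤ T⁻¹ := (inv_pos.2 hT).le
          exact add_le_add (mul_le_mul_of_nonneg_left h1 hTi)
            (mul_le_mul_of_nonneg_left h2 hT.le)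
  -- zero data: `E 0 = 0`
  have hE0 : E 0 = 0 := by
    have hφ0 : φ 0 = fun _ => 0 := funext hd0
    have h : (fun x => ft 0 x ^ 2 + fx 0 x ^ 2 + V x * φ 0 x ^ 2) = fun _ => 0 := by
      funext x
      have h1 : ft 0 x = 0 := by rw [hft]; dsimp only; rw [← deriv_time_eq hφ1 0 x, hd1 x]
      have h2 : fx 0 x = 0 := by
        rw [hfx]; dsimp only; rw [← deriv_space_eq hφ1 0 x, hφ0]; simp
      rw [h1, h2, hd0 x]; ring
    simp only [hE, h, integral_zero]
  -- Grönwall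
  have hG := norm_le_gronwallBound_of_norm_deriv_right_le (f := E) (f' := E') (δ := 0)
    (K := T⁻¹) (ε := T * N2) (a := 0) (b := T)
    (fun t _ => (hderiv t).continuousAt.continuousWithinAt)
    (fun t _ => (hderiv t).hasDerivWithinAt) (by rw [hE0, norm_zero]) hbound
  intro t ht
  have h := hG t ht
  rw [Real.norm_eq_abs, abs_of_nonneg (hEnn t), sub_zero,
    gronwallBound_of_K_ne_0 (inv_ne_zero hT.ne')] at h
  rw [he_eq t]
  refine h.trans ?_
  have hexp : Real.exp (T⁻¹ * t) ≤ Real.exp 1 := by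
    refine Real.exp_le_exp.2 ?_
    rw [inv_mul_le_iff₀ hT]; linarith [ht.2]
  have hTN : 0 ≤ T * N2 := mul_nonneg hT.le hN2
  calc 0 * Real.exp (T⁻¹ * t) + T * N2 / T⁻¹ * (Real.exp (T⁻¹ * t) - 1)
      = T ^ 2 * N2 * (Real.exp (T⁻¹ * t) - 1) := by field_simp; ring
    _ ≤ T ^ 2 * N2 * (Real.exp 1 - 1) := by
        apply mul_le_mul_of_nonneg_left _ (by positivity); linarith
    _ = (Real.exp 1 - 1) * T ^ 2 * N2 := by ring

/-- **Channel energies of solutions are non-increasing.** For a `C²` solution of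
`φ_tt − φ_xx + Vφ = 0` vanishing outside the domain of influence of `[α, β]`, `V ∈ C¹`, `V ≥ 0`,
and a non-decreasing `C¹` weight `χ`, the weighted energy `s ↦ ∫ χ(x − s) e(s, x) dx` is
non-increasing: its derivative is `−∫ χ'(x − s)((φ_t + φ_x)² + Vφ²) ≤ 0`. -/
theorem antitone_weightedEnergy (hφ : ContDiff ℝ 2 (uncurry φ)) (hV : ContDiff ℝ 1 V)
    (hVnn : ∀ x, 0 ≤ V x) (h0 : ∀ t x, (x < α - |t| ∨ β + |t| < x) → φ t x = 0)
    (hsol : ∀ t x, iteratedDeriv 2 (fun τ => φ τ x) t - iteratedDeriv 2 (φ t) x + V x * φ t x = 0)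
    {χ : ℝ → ℝ} (hχ : ContDiff ℝ 1 χ) (hχ' : ∀ u, 0 ≤ deriv χ u) :
    Antitone fun s => ∫ x, χ (x - s) *
      (deriv (fun τ => φ τ x) s ^ 2 + deriv (φ s) x ^ 2 + V x * φ s x ^ 2) := by
  set ft : ℝ → ℝ → ℝ := fun t y => fderiv ℝ (uncurry φ) (t, y) (1, 0) with hft
  set fx : ℝ → ℝ → ℝ := fun t y => fderiv ℝ (uncurry φ) (t, y) (0, 1) with hfx
  set ftt : ℝ → ℝ → ℝ := fun t y => fderiv ℝ (uncurry ft) (t, y) (1, 0) with hftt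
  set fxx : ℝ → ℝ → ℝ := fun t y => fderiv ℝ (uncurry fx) (t, y) (0, 1) with hfxx
  have heq : (fun s => ∫ x, χ (x - s) *
      (deriv (fun τ => φ τ x) s ^ 2 + deriv (φ s) x ^ 2 + V x * φ s x ^ 2))
      = fun s => ∫ x, χ (x - s) * (ft s x ^ 2 + fx s x ^ 2 + V x * φ s x ^ 2) := by
    funext s; congr 1; funext x; rw [energyDensity_eq hφ s x]
  rw [heq]
  have hres0 : ∀ t x, ftt t x - fxx t x + V x * φ t x = 0 := fun t x => by
    have h := hsol t x
    rwa [residual_eq hφ t x] at h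
  have hD : ∀ s, HasDerivAt (fun s => ∫ x, χ (x - s) * (ft s x ^ 2 + fx s x ^ 2 + V x * φ s x ^ 2))
      (∫ x, -(deriv χ (x - s) * ((ft s x ^ 2 + fx s x ^ 2 + V x * φ s x ^ 2)
        + 2 * (ft s x * fx s x)))) s := by
    intro s
    have h := hasDerivAt_weightedEnergy hφ hV h0 hχ s
    refine h.congr_deriv ?_
    congr 1; funext x
    simp only [hft, hfx, hftt, hfxx] at hres0 ⊢
    rw [hres0 s x]; ring
  refine antitone_of_deriv_nonpos (fun s => (hD s).differentiableAt) fun s => ?_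
  rw [(hD s).deriv]
  refine integral_nonpos fun x => ?_
  have h := energyDensity_add_two_flux_nonneg (hVnn x) (ft s x) (fx s x) (φ s x)
  have h' := hχ' (x - s)
  simp only [Pi.zero_apply]
  nlinarith

end Bounds

end Summit.FinalStateConjecture.FinalStateConjecture.Theorems.Blindness

end
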